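import Literature.NumberTheory.EllipticCurves.ZpExtension
import Literature.NumberTheory.EllipticCurves.H1CorestrictionIndexTwo
import Literature.NumberTheory.GaloisRepresentations.AbsGaloisGroup
import Mathlib.Topology.Algebra.ClopenNhdofOne
import HarnessLib

/-!
# Crux `MazurMCOnX1RankZero` (item stmt-BirchSwinnertonDyer-19035), line `interlude_with_torsion`, road B (B3):
# continuity bookkeeping for modules of prime order — the junk case and the lift along a `ℤ_p`-extension (helper 4a)

Cell `bsd-eis`, LEAD `cruxlead-19035` (g0), stub worker on `stub_residualGL1FinitenessOdd` (skeleton v8); `--supports`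
stmt-BirchSwinnertonDyer-19035 as a HELPER.  The stub (B3) quantifies over ALL `Γ_K`-actions on a module `M` of order `p`,
continuous or not; this file supplies the two generic facts that dispose of the non-continuous ("junk") case, used by
`…InterludeResidualGL1Tame` to prove the tame input [Tame] of `…InterludeResidualGL1Finiteness` unconditionally:

* §1 `smul_eq_self_or_injective_sub` — on a group of prime order each `g` acts trivially or with `g - 1` injective;
  **`contOneCocycles_eq_zero_of_not_isClosed_ker`** — if the kernel `N` of the action of a topological group `G` on `M`
  (prime order, discrete) is NOT closed, every continuous crossed homomorphism `G → M` vanishes (a `g₀ ∈ N̄ ∖ N` satisfies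
  `g₀ • φ(h) = φ(h)` by continuity and the cocycle identity); `continuous_smul_of_isClosed_ker` — a closed kernel of finite
  index is open, so the action is continuous; hence **`discreteH1_eq_zero_of_not_continuous`**: `H¹_cont(G, M) = 0` for a
  non-continuous action on a module of prime order.
* §2 **`continuous_smul_of_continuous_smul_kerSubgroup`** — for a `ℤ_p`-extension `κ` of a number field `K` and a finite `M`,
  continuity of the action of `Gal(K̄/K_∞) = ker κ` implies continuity of the action of `Γ_K` (profinite `Γ_K`,
  `ProfiniteGrp.exist_openNormalSubgroup_sub_open_nhds_of_one`: an open normal `W` with `W ∩ ker κ` acting trivially;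
  `#Aut(M)`-th powers act trivially, `[Γ_K : W]`-th powers lie in `W`, so the open subgroup `W ∩ κ⁻¹(p^e ℤ_p)`,
  `p^e ∥ #Aut(M)·[Γ_K : W]`, acts trivially).

HONEST FRAMING.  Generic topological-group bookkeeping; no definition, no named fact, no `sorry`; nothing about BSD is asserted.

References: J.-P. Serre, *Galois Cohomology* I §2.2, §5.1 [SerreGaloisCohomology1997]; L. Washington, *Introduction to
Cyclotomic Fields* §13.1 [Washington1997].
-/

set_option linter.dupNamespace false
set_option autoImplicit false

noncomputable section

open scoped Classical Pointwise

namespace Summit.BirchSwinnertonDyer.BirchSwinnertonDyer.Theorems.InterludeWithTorsion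

open Field Literature.NumberTheory.EllipticCurves Literature.NumberTheory.GaloisRepresentations

/-! ## §1 Junk case: a module of prime order with a NON-continuous action has no continuous cocycles -/

section Vanishing

variable {G : Type} [Group G] [TopologicalSpace G] [IsTopologicalGroup G]
  {M : Type} [AddCommGroup M] [DistribMulAction G M] [TopologicalSpace M] [DiscreteTopology M]

omit [TopologicalSpace G] [IsTopologicalGroup G] [TopologicalSpace M] [DiscreteTopology M] in
/-- On a group of prime order every group element acts either trivially or with `m ↦ g • m - m` injective
(the kernel of the endomorphism `g - 1` is a subgroup of a group of prime order). [folklore] -/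
theorem smul_eq_self_or_injective_sub (hp : (Nat.card M).Prime) (g : G) :
    (∀ m : M, g • m = m) ∨ Function.Injective fun m : M ↦ g • m - m := by
  let f : M →+ M := DistribSMul.toAddMonoidHom M g - AddMonoidHom.id M
  have hf : ∀ m, f m = g • m - m := fun m ↦ rfl
  haveI : Finite M := Nat.finite_of_card_ne_zero hp.ne_zero
  rcases hp.eq_one_or_self_of_dvd _ (f.ker.card_addSubgroup_dvd_card) with h1 | hcard
  · right
    have hbot : f.ker = ⊥ := AddSubgroup.eq_bot_of_card_eq f.ker h1
    intro a b hab
    have : a - b ∈ f.ker := by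
      rw [AddMonoidHom.mem_ker, map_sub, hf, hf]
      exact sub_eq_zero.mpr hab
    rw [hbot, AddSubgroup.mem_bot] at this
    exact sub_eq_zero.mp this
  · left
    have htop : f.ker = ⊤ := AddSubgroup.eq_top_of_card_eq f.ker hcard
    intro m
    have hm : m ∈ f.ker := htop ▸ AddSubgroup.mem_top m
    rw [AddMonoidHom.mem_ker, hf] at hm
    exact sub_eq_zero.mp hm

/-- **Junk case, cocycle level**: if `M` has prime order and the kernel of the action of `G` on `M` is NOT closed,
every continuous crossed homomorphism `G → M` vanishes (for `g₀` in the closure of the kernel but outside it,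
continuity gives `φ(g₀ h) = φ(g₀) + φ(h)`, the cocycle identity gives `φ(g₀ h) = φ(g₀) + g₀ • φ(h)`, and `g₀ - 1` is
injective). [folklore] -/
theorem contOneCocycles_eq_zero_of_not_isClosed_ker (hp : (Nat.card M).Prime)
    (hN : ¬ IsClosed ((MulAction.toPermHom G M).ker : Set G)) (φ : contOneCocycles (discreteTopRep G M)) :
    φ = 0 := by
  set N : Subgroup G := (MulAction.toPermHom G M).ker with hNdef
  have hmemN : ∀ g : G, g ∈ N ↔ ∀ m : M, g • m = m := fun g ↦ by
    rw [hNdef, MonoidHom.mem_ker, Equiv.ext_iff]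
    rfl
  -- some `g₀` in the closure of `N` outside `N`
  obtain ⟨g₀, hg₀c, hg₀N⟩ : ∃ g₀, g₀ ∈ closure (N : Set G) ∧ g₀ ∉ N := by
    by_contra h
    push Not at h
    exact hN (closure_subset_iff_isClosed.mp fun g hg ↦ h g hg)
  have hinj : Function.Injective fun m : M ↦ g₀ • m - m :=
    (smul_eq_self_or_injective_sub hp g₀).resolve_left fun h ↦ hg₀N ((hmemN g₀).mpr h)
  apply Subtype.ext
  ext h
  -- `F(g) = φ(g h) - φ(g)` is continuous, equal to `φ h` on `N`, hence at `g₀`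
  have hF : Continuous fun g : G ↦ φ.1 (g * h) - φ.1 g :=
    (φ.1.continuous.comp (continuous_id.mul continuous_const)).sub φ.1.continuous
  have hcl : IsClosed {g : G | φ.1 (g * h) - φ.1 g = φ.1 h} := isClosed_eq hF continuous_const
  have hsub : (N : Set G) ⊆ {g : G | φ.1 (g * h) - φ.1 g = φ.1 h} := fun n hn ↦ by
    have hn' := (hmemN n).mp hn
    change φ.1 (n * h) - φ.1 n = φ.1 h
    rw [cocycle_mul' φ n h, hn', add_sub_cancel_left]
  have h1 : φ.1 (g₀ * h) - φ.1 g₀ = φ.1 h := hcl.closure_subset_iff.mpr hsub hg₀c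
  rw [cocycle_mul' φ g₀ h, add_sub_cancel_left] at h1
  -- `g₀ • φ h = φ h`, so `φ h = 0`
  have h2 : (fun m : M ↦ g₀ • m - m) (φ.1 h) = (fun m : M ↦ g₀ • m - m) 0 := by
    simp only [smul_zero, h1, sub_self]
  exact hinj h2

omit [DiscreteTopology M] in
/-- If the kernel of the action on a finite module IS closed, it is open (finite index), so the action is continuous.
[folklore] -/
theorem continuous_smul_of_isClosed_ker [Finite M] (hN : IsClosed ((MulAction.toPermHom G M).ker : Set G)) (m : M) :
    Continuous fun g : G ↦ g • m := by
  set N : Subgroup G := (MulAction.toPermHom G M).ker with hNdef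
  haveI : Finite (G ⧸ N) :=
    Finite.of_equiv _ (QuotientGroup.quotientKerEquivRange (MulAction.toPermHom G M)).symm.toEquiv
  haveI : N.FiniteIndex := Subgroup.finiteIndex_of_finite_quotient
  have hopen : IsOpen (N : Set G) := Subgroup.isOpen_of_isClosed_of_finiteIndex N hN
  rw [continuous_iff_continuousAt]
  intro g
  have hmem : (fun x ↦ g * x) '' (N : Set G) ∈ nhds g :=
    ((Homeomorph.mulLeft g).isOpenMap _ hopen).mem_nhds ⟨1, N.one_mem, mul_one g⟩
  have heq : (fun x : G ↦ x • m) =ᶠ[nhds g] fun _ ↦ g • m := by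
    filter_upwards [hmem]
    rintro _ ⟨n, hn, rfl⟩
    have hn' : n • m = m := by
      have := (MonoidHom.mem_ker.mp hn)
      exact congrFun (congrArg (fun e : Equiv.Perm M ↦ (e : M → M)) this) m
    rw [mul_smul, hn']
  exact (continuousAt_const.congr heq.symm)

/-- **`H¹_cont(G, M) = 0` for a module of prime order with a non-continuous action.** [folklore] -/
theorem discreteH1_eq_zero_of_not_continuous (hp : (Nat.card M).Prime)
    (h : ¬ ∀ m : M, Continuous fun g : G ↦ g • m) (c : discreteH1 G M) : c = 0 := by
  haveI : Finite M := Nat.finite_of_card_ne_zero hp.ne_zero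
  have hN : ¬ IsClosed ((MulAction.toPermHom G M).ker : Set G) := fun hc ↦ h (continuous_smul_of_isClosed_ker hc)
  obtain ⟨φ, rfl⟩ := oneCocycleClass_surjective _ c
  rw [contOneCocycles_eq_zero_of_not_isClosed_ker hp hN φ, oneCocycleClass_zero]

end Vanishing


/-! ## §2 Continuity lifts from `Gal(K̄/K_∞)` to `Γ_K` along a `ℤ_p`-extension -/

section Lift

variable {K : Type} [Field K] [NumberField K] {p : ℕ} [Fact p.Prime] (κ : ZpExtension K p)
  {M : Type} [AddCommGroup M] [DistribMulAction (absoluteGaloisGroup K) M] [TopologicalSpace M] [DiscreteTopology M]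

/-- **If `Gal(K̄/K_∞)` acts continuously on a finite `M`, so does `Γ_K`** (`K_∞/K` a `ℤ_p`-extension).  Proof: the kernel
`N` of the action meets `H = ker κ` in an open subgroup of `H`, so some open normal `W ≤ Γ_K` has `W ∩ H ⊆ N` (profinite
`Γ_K`); with `n = #Aut(M)` and `m = [Γ_K : W]`, every `g ∈ W` with `p^{v_p(nm)} ∣ κ(g)` is `≡ (g₁^m)^n` modulo `W ∩ H` for some
`g₁`, hence lies in `N`; so `N` contains an open subgroup. [folklore] -/
theorem continuous_smul_of_continuous_smul_kerSubgroup [Finite M]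
    (h : ∀ m : M, Continuous fun g : κ.kerSubgroup ↦ g • m) (m : M) :
    Continuous fun g : absoluteGaloisGroup K ↦ g • m := by
  have hp : p.Prime := Fact.out
  set G := absoluteGaloisGroup K
  set N : Subgroup (absoluteGaloisGroup K) := (MulAction.toPermHom (absoluteGaloisGroup K) M).ker with hNdef
  have hmemN : ∀ g : absoluteGaloisGroup K, g ∈ N ↔ ∀ m : M, g • m = m := fun g ↦ by
    rw [hNdef, MonoidHom.mem_ker, Equiv.ext_iff]
    rfl
  -- Step 1: the elements of `H = ker κ` acting trivially form an open subset of `H`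
  set SH : Set κ.kerSubgroup := {x | ∀ m : M, x • m = m} with hSH
  have hSHopen : IsOpen SH := by
    have : SH = ⋂ m : M, (fun x : κ.kerSubgroup ↦ x • m) ⁻¹' {m} := by
      ext x; simp [hSH]
    rw [this]
    exact isOpen_iInter_of_finite fun m ↦ (h m).isOpen_preimage _ (isOpen_discrete _)
  -- Step 2: an open `V ⊆ Γ_K` with `V ∩ H = SH`, and an open normal subgroup `W ⊆ V`
  obtain ⟨V, hVopen, hV⟩ := isOpen_induced_iff.mp hSHopen
  have h1V : (1 : absoluteGaloisGroup K) ∈ V := by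
    have : (1 : κ.kerSubgroup) ∈ Subtype.val ⁻¹' V := by
      rw [hV]; intro m'; exact one_smul _ m'
    exact this
  obtain ⟨W, hWV⟩ := ProfiniteGrp.exist_openNormalSubgroup_sub_open_nhds_of_one hVopen h1V
  have hWH : ∀ g : absoluteGaloisGroup K, g ∈ (W : Subgroup (absoluteGaloisGroup K)) → g ∈ κ.kerSubgroup → g ∈ N := by
    intro g hgW hgH
    have : (⟨g, hgH⟩ : κ.kerSubgroup) ∈ Subtype.val ⁻¹' V := hWV hgW
    rw [hV] at this
    exact (hmemN g).mpr fun m' ↦ this m'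
  -- Step 3: `n`-th powers act trivially, `m`-th powers lie in `W`
  set n : ℕ := Nat.card (Equiv.Perm M) with hn
  have hnN : ∀ g : absoluteGaloisGroup K, g ^ n ∈ N := fun g ↦ by
    rw [hNdef, MonoidHom.mem_ker, map_pow]
    exact pow_card_eq_one'
  have hn0 : n ≠ 0 := Nat.card_pos.ne'
  haveI : Finite (absoluteGaloisGroup K ⧸ (W : Subgroup (absoluteGaloisGroup K))) :=
    Subgroup.quotient_finite_of_isOpen _ W.isOpen
  set k : ℕ := (W : Subgroup (absoluteGaloisGroup K)).index with hk
  have hk0 : k ≠ 0 := Subgroup.index_ne_zero_of_finite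
  have hkW : ∀ g : absoluteGaloisGroup K, g ^ k ∈ (W : Subgroup (absoluteGaloisGroup K)) := fun g ↦
    Subgroup.pow_index_mem _ g
  -- Step 4: `n k = p^e u` with `u` a unit of `ℤ_p`
  obtain ⟨e, u, hu, hnk⟩ := Nat.exists_eq_pow_mul_and_not_dvd (mul_ne_zero hn0 hk0) p hp.one_lt.ne'
  have hunit : IsUnit ((u : ℕ) : ℤ_[p]) := by
    rw [PadicInt.isUnit_iff]
    refine le_antisymm (PadicInt.norm_le_one _) (not_lt.mp fun hlt ↦ hu ?_)
    have := (PadicInt.norm_int_lt_one_iff_dvd (u : ℤ)).mp (by exact_mod_cast hlt)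
    exact_mod_cast this
  obtain ⟨uu, huu⟩ := hunit
  -- Step 5: the open subgroup `W ⊓ κ⁻¹(p^e ℤ_p)` lies in `N`
  have hsub : (W : Subgroup (absoluteGaloisGroup K)) ⊓ κ.layerSubgroup e ≤ N := by
    intro g hg
    obtain ⟨hgW, hge⟩ := Subgroup.mem_inf.mp hg
    rw [ZpExtension.mem_layerSubgroup] at hge
    obtain ⟨y', hy'⟩ := hge
    -- `g₁` with `κ g₁ = y' u⁻¹`, so that `κ (g₁ ^ (n k)) = κ g`
    obtain ⟨g₁, hg₁⟩ := κ.surjective (Multiplicative.ofAdd (y' * ↑uu⁻¹))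
    have hg₁' : κ g₁ = Multiplicative.ofAdd (y' * ↑uu⁻¹) := hg₁
    have hκ3 : κ ((g₁ ^ k) ^ n) = κ g := by
      apply Multiplicative.toAdd.injective
      rw [← pow_mul, map_pow, hg₁', toAdd_pow, toAdd_ofAdd, nsmul_eq_mul, mul_comm k n, hnk, hy', Nat.cast_mul,
        Nat.cast_pow, ← huu]
      calc ((p : ℤ_[p]) ^ e * ↑uu) * (y' * ↑uu⁻¹) = (p : ℤ_[p]) ^ e * y' * (↑uu * ↑uu⁻¹) := by ring
        _ = (p : ℤ_[p]) ^ e * y' := by rw [Units.mul_inv, mul_one]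
    have h3W : (g₁ ^ k) ^ n ∈ (W : Subgroup (absoluteGaloisGroup K)) := Subgroup.pow_mem _ (hkW g₁) n
    have h3N : (g₁ ^ k) ^ n ∈ N := hnN _
    have hq : g * ((g₁ ^ k) ^ n)⁻¹ ∈ N := by
      refine hWH _ (Subgroup.mul_mem _ hgW (Subgroup.inv_mem _ h3W)) ?_
      rw [ZpExtension.mem_kerSubgroup, map_mul, map_inv, hκ3, mul_inv_cancel]
    have := Subgroup.mul_mem _ hq h3N
    rwa [inv_mul_cancel_right] at this
  -- Step 6: `N` is open, hence the orbit map is locally constant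
  have hNopen : IsOpen (N : Set (absoluteGaloisGroup K)) :=
    Subgroup.isOpen_mono hsub (W.isOpen.inter (κ.isOpen_layerSubgroup e))
  exact continuous_smul_of_isClosed_ker (Subgroup.isClosed_of_isOpen N hNopen) m

end Lift


end Summit.BirchSwinnertonDyer.BirchSwinnertonDyer.Theorems.InterludeWithTorsion

end
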